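import Literature.Probability.Percolation.BoxCrossingUpperBound
import Literature.Probability.Percolation.Z2HalfPlaneThreeArm

/-!
# Stub `stub_boundaryArmTightness`, lattice input II: quarter turns about a site
# (line `excursion-kernel-covariance`, crux `RectilinearCardy`, stmt-CriticalPhenomena-5660)

The clockwise quarter turn of `ℤ²` about a site `c`,
`σ_c = shift(c) ∘ (w ↦ (w₁, -w₀)) ∘ shift(-c)`, an automorphism of the square lattice
(`zdShiftIso`, `zdSignedPermIso` of the tree), written out as a term (no new definition):

* coordinates of `σ_c` and `σ_c⁻¹` (`quarterTurn_apply`, `quarterTurn_symm_apply`); the mesh point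
  of `σ_c⁻¹ x` is obtained from that of `x` by the counter-clockwise rotation by `i` about `δ c`
  (`meshPoint_quarterTurn_symm`), and iterating, by `i^k` (`meshPoint_quarterTurn_symm_iterate`);
* transport of open walks along relabelling (`map_edges_mem_of_edges_mem_relabel`,
  `exists_walk_of_edges_mem_relabel_iterate`): a walk open in `σ^k ω` is carried by `σ⁻ᵏ` to a
  walk open in `ω`;
* **rotation of the four long-way crossings** (`fourWalks_relabel_quarterTurn`,
  `fourWalks_relabel_quarterTurn_iterate`): the datum "open left-right crossings of the top and
  bottom boxes and open top-bottom crossings of the left and right boxes of `c + A(l)`" is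
  invariant under `ω ↦ σ_c ω` (the four boxes are permuted, two crossings reversed).
-/

noncomputable section

open Set Filter Topology MeasureTheory
open Literature.Probability.Percolation
open Literature.Probability.LatticeModels (Site zdGraph meshPoint)

namespace Summit.CriticalPhenomena.CardyFormulaZ2.Cruxes.RectilinearCardy.ExcursionKernelCovariance

/-! ### The quarter turn about a site -/

/-- Coordinates of the clockwise quarter turn about `c`: `(x₀, x₁) ↦ c + (x₁ - c₁, -(x₀ - c₀))`.
[folklore] -/
theorem quarterTurn_apply (c x : Site 2) :
    ((zdShiftIso c).comp ((zdSignedPermIso (Equiv.swap (0 : Fin 2) 1) ![1, -1]).comp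
      (zdShiftIso (-c)))) x 0 = x 1 - c 1 + c 0 ∧
    ((zdShiftIso c).comp ((zdSignedPermIso (Equiv.swap (0 : Fin 2) 1) ![1, -1]).comp
      (zdShiftIso (-c)))) x 1 = -(x 0 - c 0) + c 1 := by
  simp only [SimpleGraph.Iso.coe_comp, Function.comp_apply, zdShiftIso_apply,
    zdSignedPermIso_apply, Literature.Probability.LatticeModels.Site.signedPerm_apply,
    Pi.add_apply, Pi.neg_apply, Equiv.symm_swap, Equiv.swap_apply_left,
    Equiv.swap_apply_right, Matrix.cons_val_zero, Matrix.cons_val_one]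
  simp; constructor <;> ring

/-- Coordinates of the inverse (counter-clockwise) quarter turn about `c`:
`(x₀, x₁) ↦ c + (-(x₁ - c₁), x₀ - c₀)`. [folklore] -/
theorem quarterTurn_symm_apply (c x : Site 2) :
    ((zdShiftIso c).comp ((zdSignedPermIso (Equiv.swap (0 : Fin 2) 1) ![1, -1]).comp
      (zdShiftIso (-c)))).symm x 0 = -(x 1 - c 1) + c 0 ∧
    ((zdShiftIso c).comp ((zdSignedPermIso (Equiv.swap (0 : Fin 2) 1) ![1, -1]).comp
      (zdShiftIso (-c)))).symm x 1 = (x 0 - c 0) + c 1 := by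
  set σ := (zdShiftIso c).comp ((zdSignedPermIso (Equiv.swap (0 : Fin 2) 1) ![1, -1]).comp
    (zdShiftIso (-c))) with hσ
  have h := quarterTurn_apply c (σ.symm x)
  rw [← hσ, RelIso.apply_symm_apply] at h
  omega

/-- **The mesh point of `σ_c⁻¹ x` is the rotation by `i` about `δ c` of the mesh point of `x`.**
[folklore] -/
theorem meshPoint_quarterTurn_symm (c x : Site 2) (δ : ℝ) :
    meshPoint δ (((zdShiftIso c).comp ((zdSignedPermIso (Equiv.swap (0 : Fin 2) 1) ![1, -1]).comp
      (zdShiftIso (-c)))).symm x) = meshPoint δ c + Complex.I * (meshPoint δ x - meshPoint δ c) := by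
  obtain ⟨h0, h1⟩ := quarterTurn_symm_apply c x
  apply Complex.ext
  · simp only [Literature.Probability.LatticeModels.meshPoint_re, h0, Complex.add_re,
      Complex.mul_re, Complex.I_re, Complex.sub_re, zero_mul, Complex.I_im, Complex.sub_im,
      Literature.Probability.LatticeModels.meshPoint_im, one_mul, zero_sub]
    push_cast; ring
  · simp only [Literature.Probability.LatticeModels.meshPoint_im, h1, Complex.add_im,
      Complex.mul_im, Complex.I_re, Complex.sub_im, zero_mul, Complex.I_im, Complex.sub_re,
      Literature.Probability.LatticeModels.meshPoint_re, one_mul]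
    push_cast; ring

/-- **Iterating: the mesh point of `σ_c⁻ᵏ x` is the rotation by `i^k` about `δ c`.** [folklore] -/
theorem meshPoint_quarterTurn_symm_iterate (c : Site 2) (δ : ℝ) (k : ℕ) (x : Site 2) :
    meshPoint δ ((((zdShiftIso c).comp ((zdSignedPermIso (Equiv.swap (0 : Fin 2) 1) ![1, -1]).comp
      (zdShiftIso (-c)))).symm)^[k] x) =
      meshPoint δ c + Complex.I ^ k * (meshPoint δ x - meshPoint δ c) := by
  induction k generalizing x with
  | zero => simp
  | succ k ih =>
    rw [Function.iterate_succ_apply', meshPoint_quarterTurn_symm, ih, pow_succ]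
    ring

/-! ### Transport of open walks along relabelling -/

/-- **A walk open in the relabelled configuration `φ ω` is carried by `φ⁻¹` to a walk open in
`ω`.** [folklore] -/
theorem map_edges_mem_of_edges_mem_relabel (φ : zdGraph 2 ≃g zdGraph 2) {ω : BondConfig (Site 2)}
    {u v : Site 2} (W : (zdGraph 2).Walk u v)
    (hW : ∀ e ∈ W.edges, e ∈ BondConfig.relabel (sym2Equiv φ.toEquiv) ω) :
    ∀ e ∈ (W.map φ.symm.toHom).edges, e ∈ ω := by
  intro e he
  rw [SimpleGraph.Walk.edges_map, List.mem_map] at he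
  obtain ⟨e₀, he₀, rfl⟩ := he
  have := hW e₀ he₀
  rw [BondConfig.mem_relabel_iff, sym2Equiv_symm, sym2Equiv_apply] at this
  exact this

/-- Conversely, a walk open in `ω` is carried by `φ` to a walk open in `φ ω`. [folklore] -/
theorem map_edges_mem_relabel_of_edges_mem (φ : zdGraph 2 ≃g zdGraph 2) {ω : BondConfig (Site 2)}
    {u v : Site 2} (W : (zdGraph 2).Walk u v) (hW : ∀ e ∈ W.edges, e ∈ ω) :
    ∀ e ∈ (W.map φ.toHom).edges, e ∈ BondConfig.relabel (sym2Equiv φ.toEquiv) ω := by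
  intro e he
  rw [SimpleGraph.Walk.edges_map, List.mem_map] at he
  obtain ⟨e₀, he₀, rfl⟩ := he
  rw [BondConfig.mem_relabel_iff, sym2Equiv_symm, sym2Equiv_apply]
  have : Sym2.map (⇑φ.toEquiv.symm) (Sym2.map (⇑φ.toHom) e₀) = e₀ := by
    rw [Sym2.map_map]
    have hid : (⇑φ.toEquiv.symm ∘ ⇑φ.toHom) = id := by
      funext w
      exact φ.toEquiv.symm_apply_apply w
    rw [hid]
    exact congrFun Sym2.map_id e₀
  rw [this]
  exact hW e₀ he₀

/-- The vertices of a mapped walk. [folklore] -/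
theorem mem_support_map_iff {G G' : SimpleGraph (Site 2)} (f : G →g G') {u v : Site 2}
    (W : G.Walk u v) (z : Site 2) : z ∈ (W.map f).support ↔ ∃ w ∈ W.support, f w = z := by
  rw [SimpleGraph.Walk.support_map, List.mem_map]

/-- **Iterated transport.** A walk open in `φ^k ω` (relabelling iterated `k` times) is carried by
`φ⁻ᵏ` to a walk open in `ω`, with the corresponding vertices. [folklore] -/
theorem exists_walk_of_edges_mem_relabel_iterate (φ : zdGraph 2 ≃g zdGraph 2) (k : ℕ) :
    ∀ (ω : BondConfig (Site 2)) {u v : Site 2} (W : (zdGraph 2).Walk u v),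
      (∀ e ∈ W.edges, e ∈ (BondConfig.relabel (sym2Equiv φ.toEquiv))^[k] ω) →
      ∃ W' : (zdGraph 2).Walk ((φ.symm)^[k] u) ((φ.symm)^[k] v), (∀ e ∈ W'.edges, e ∈ ω) ∧
        ∀ z, z ∈ W'.support ↔ ∃ w ∈ W.support, (φ.symm)^[k] w = z := by
  induction k with
  | zero =>
    intro ω u v W hW
    exact ⟨W, hW, fun z => ⟨fun h => ⟨z, h, rfl⟩, fun ⟨w, hw, hwz⟩ => hwz ▸ hw⟩⟩
  | succ k ih =>
    intro ω u v W hW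
    rw [Function.iterate_succ_apply] at hW
    obtain ⟨W', hW'e, hW's⟩ := ih _ W hW
    refine ⟨(W'.map φ.symm.toHom).copy (Function.iterate_succ_apply' _ _ _).symm
      (Function.iterate_succ_apply' _ _ _).symm, ?_, fun z => ?_⟩
    · intro e he
      rw [SimpleGraph.Walk.edges_copy] at he
      exact map_edges_mem_of_edges_mem_relabel φ W' hW'e e he
    · rw [SimpleGraph.Walk.support_copy, mem_support_map_iff]
      constructor
      · rintro ⟨w', hw', rfl⟩
        obtain ⟨w, hw, rfl⟩ := (hW's w').1 hw'
        exact ⟨w, hw, by rw [Function.iterate_succ_apply']; rfl⟩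
      · rintro ⟨w, hw, rfl⟩
        exact ⟨(φ.symm)^[k] w, (hW's _).2 ⟨w, hw, rfl⟩, by rw [Function.iterate_succ_apply']; rfl⟩

/-! ### Rotation of the four long-way crossings -/

/-- **The four long-way crossings of `c + A(l)` are a rotation-invariant datum.** If `ω` has open
lattice walks crossing the top and bottom boxes of `c + A(l)` from left to right and the left and
right boxes from bottom to top, then so has the configuration `σ_c ω` turned clockwise by a
quarter turn about `c` (the left crossing becomes the top one, the top one reversed the right
one, the right one the bottom one, the bottom one reversed the left one). [folklore] -/
theorem fourWalks_relabel_quarterTurn {ω : BondConfig (Site 2)} {c : Site 2} {l : ℕ}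
    (h : (∃ (a b : Site 2) (T : (zdGraph 2).Walk a b), a 0 = c 0 - 3 * l ∧ b 0 = c 0 + 3 * l ∧
        (∀ z ∈ T.support, c 0 - 3 * l ≤ z 0 ∧ z 0 ≤ c 0 + 3 * l ∧
          c 1 + l + 1 ≤ z 1 ∧ z 1 ≤ c 1 + 3 * l) ∧ ∀ e ∈ T.edges, e ∈ ω) ∧
      (∃ (a b : Site 2) (B : (zdGraph 2).Walk a b), a 0 = c 0 - 3 * l ∧ b 0 = c 0 + 3 * l ∧
        (∀ z ∈ B.support, c 0 - 3 * l ≤ z 0 ∧ z 0 ≤ c 0 + 3 * l ∧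
          c 1 - 3 * l ≤ z 1 ∧ z 1 ≤ c 1 - l - 1) ∧ ∀ e ∈ B.edges, e ∈ ω) ∧
      (∃ (a b : Site 2) (L : (zdGraph 2).Walk a b), a 1 = c 1 - 3 * l ∧ b 1 = c 1 + 3 * l ∧
        (∀ z ∈ L.support, c 0 - 3 * l ≤ z 0 ∧ z 0 ≤ c 0 - l - 1 ∧
          c 1 - 3 * l ≤ z 1 ∧ z 1 ≤ c 1 + 3 * l) ∧ ∀ e ∈ L.edges, e ∈ ω) ∧
      (∃ (a b : Site 2) (R : (zdGraph 2).Walk a b), a 1 = c 1 - 3 * l ∧ b 1 = c 1 + 3 * l ∧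
        (∀ z ∈ R.support, c 0 + l + 1 ≤ z 0 ∧ z 0 ≤ c 0 + 3 * l ∧
          c 1 - 3 * l ≤ z 1 ∧ z 1 ≤ c 1 + 3 * l) ∧ ∀ e ∈ R.edges, e ∈ ω)) :
    (∃ (a b : Site 2) (T : (zdGraph 2).Walk a b), a 0 = c 0 - 3 * l ∧ b 0 = c 0 + 3 * l ∧
        (∀ z ∈ T.support, c 0 - 3 * l ≤ z 0 ∧ z 0 ≤ c 0 + 3 * l ∧
          c 1 + l + 1 ≤ z 1 ∧ z 1 ≤ c 1 + 3 * l) ∧ ∀ e ∈ T.edges, e ∈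
          BondConfig.relabel (sym2Equiv ((zdShiftIso c).comp ((zdSignedPermIso
            (Equiv.swap (0 : Fin 2) 1) ![1, -1]).comp (zdShiftIso (-c)))).toEquiv) ω) ∧
      (∃ (a b : Site 2) (B : (zdGraph 2).Walk a b), a 0 = c 0 - 3 * l ∧ b 0 = c 0 + 3 * l ∧
        (∀ z ∈ B.support, c 0 - 3 * l ≤ z 0 ∧ z 0 ≤ c 0 + 3 * l ∧
          c 1 - 3 * l ≤ z 1 ∧ z 1 ≤ c 1 - l - 1) ∧ ∀ e ∈ B.edges, e ∈
          BondConfig.relabel (sym2Equiv ((zdShiftIso c).comp ((zdSignedPermIso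
            (Equiv.swap (0 : Fin 2) 1) ![1, -1]).comp (zdShiftIso (-c)))).toEquiv) ω) ∧
      (∃ (a b : Site 2) (L : (zdGraph 2).Walk a b), a 1 = c 1 - 3 * l ∧ b 1 = c 1 + 3 * l ∧
        (∀ z ∈ L.support, c 0 - 3 * l ≤ z 0 ∧ z 0 ≤ c 0 - l - 1 ∧
          c 1 - 3 * l ≤ z 1 ∧ z 1 ≤ c 1 + 3 * l) ∧ ∀ e ∈ L.edges, e ∈
          BondConfig.relabel (sym2Equiv ((zdShiftIso c).comp ((zdSignedPermIso
            (Equiv.swap (0 : Fin 2) 1) ![1, -1]).comp (zdShiftIso (-c)))).toEquiv) ω) ∧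
      (∃ (a b : Site 2) (R : (zdGraph 2).Walk a b), a 1 = c 1 - 3 * l ∧ b 1 = c 1 + 3 * l ∧
        (∀ z ∈ R.support, c 0 + l + 1 ≤ z 0 ∧ z 0 ≤ c 0 + 3 * l ∧
          c 1 - 3 * l ≤ z 1 ∧ z 1 ≤ c 1 + 3 * l) ∧ ∀ e ∈ R.edges, e ∈
          BondConfig.relabel (sym2Equiv ((zdShiftIso c).comp ((zdSignedPermIso
            (Equiv.swap (0 : Fin 2) 1) ![1, -1]).comp (zdShiftIso (-c)))).toEquiv) ω) := by
  set σ := (zdShiftIso c).comp ((zdSignedPermIso (Equiv.swap (0 : Fin 2) 1) ![1, -1]).comp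
    (zdShiftIso (-c))) with hσ
  obtain ⟨⟨aT, bT, T, haT, hbT, hTs, hTe⟩, ⟨aB, bB, B, haB, hbB, hBs, hBe⟩,
    ⟨aL, bL, L, haL, hbL, hLs, hLe⟩, ⟨aR, bR, R, haR, hbR, hRs, hRe⟩⟩ := h
  have happ : ∀ x : Site 2, σ x 0 = x 1 - c 1 + c 0 ∧ σ x 1 = -(x 0 - c 0) + c 1 :=
    fun x => quarterTurn_apply c x
  have hsupp : ∀ {u v : Site 2} (W : (zdGraph 2).Walk u v) (z : Site 2),
      z ∈ (W.map σ.toHom).support → ∃ w ∈ W.support, σ w = z := fun W z hz =>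
    (mem_support_map_iff σ.toHom W z).1 hz
  refine ⟨⟨σ aL, σ bL, L.map σ.toHom, ?_, ?_, ?_, map_edges_mem_relabel_of_edges_mem σ L hLe⟩,
    ⟨σ aR, σ bR, R.map σ.toHom, ?_, ?_, ?_, map_edges_mem_relabel_of_edges_mem σ R hRe⟩,
    ⟨σ bB, σ aB, (B.map σ.toHom).reverse, ?_, ?_, ?_, ?_⟩,
    ⟨σ bT, σ aT, (T.map σ.toHom).reverse, ?_, ?_, ?_, ?_⟩⟩
  · have := happ aL; omega
  · have := happ bL; omega
  · intro z hz
    obtain ⟨w, hw, rfl⟩ := hsupp L z hz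
    have := happ w; have := hLs w hw; omega
  · have := happ aR; omega
  · have := happ bR; omega
  · intro z hz
    obtain ⟨w, hw, rfl⟩ := hsupp R z hz
    have := happ w; have := hRs w hw; omega
  · have := happ bB; omega
  · have := happ aB; omega
  · intro z hz
    rw [SimpleGraph.Walk.support_reverse, List.mem_reverse] at hz
    obtain ⟨w, hw, rfl⟩ := hsupp B z hz
    have := happ w; have := hBs w hw; omega
  · intro e he
    rw [SimpleGraph.Walk.edges_reverse, List.mem_reverse] at he
    exact map_edges_mem_relabel_of_edges_mem σ B hBe e he
  · have := happ bT; omega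
  · have := happ aT; omega
  · intro z hz
    rw [SimpleGraph.Walk.support_reverse, List.mem_reverse] at hz
    obtain ⟨w, hw, rfl⟩ := hsupp T z hz
    have := happ w; have := hTs w hw; omega
  · intro e he
    rw [SimpleGraph.Walk.edges_reverse, List.mem_reverse] at he
    exact map_edges_mem_relabel_of_edges_mem σ T hTe e he

/-- **Iterated rotation of the four long-way crossings**: the datum passes from `ω` to
`σ_c^k ω` for every `k`. [folklore] -/
theorem fourWalks_relabel_quarterTurn_iterate {c : Site 2} {l : ℕ} (k : ℕ) :
    ∀ {ω : BondConfig (Site 2)},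
    ((∃ (a b : Site 2) (T : (zdGraph 2).Walk a b), a 0 = c 0 - 3 * l ∧ b 0 = c 0 + 3 * l ∧
        (∀ z ∈ T.support, c 0 - 3 * l ≤ z 0 ∧ z 0 ≤ c 0 + 3 * l ∧
          c 1 + l + 1 ≤ z 1 ∧ z 1 ≤ c 1 + 3 * l) ∧ ∀ e ∈ T.edges, e ∈ ω) ∧
      (∃ (a b : Site 2) (B : (zdGraph 2).Walk a b), a 0 = c 0 - 3 * l ∧ b 0 = c 0 + 3 * l ∧
        (∀ z ∈ B.support, c 0 - 3 * l ≤ z 0 ∧ z 0 ≤ c 0 + 3 * l ∧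
          c 1 - 3 * l ≤ z 1 ∧ z 1 ≤ c 1 - l - 1) ∧ ∀ e ∈ B.edges, e ∈ ω) ∧
      (∃ (a b : Site 2) (L : (zdGraph 2).Walk a b), a 1 = c 1 - 3 * l ∧ b 1 = c 1 + 3 * l ∧
        (∀ z ∈ L.support, c 0 - 3 * l ≤ z 0 ∧ z 0 ≤ c 0 - l - 1 ∧
          c 1 - 3 * l ≤ z 1 ∧ z 1 ≤ c 1 + 3 * l) ∧ ∀ e ∈ L.edges, e ∈ ω) ∧
      (∃ (a b : Site 2) (R : (zdGraph 2).Walk a b), a 1 = c 1 - 3 * l ∧ b 1 = c 1 + 3 * l ∧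
        (∀ z ∈ R.support, c 0 + l + 1 ≤ z 0 ∧ z 0 ≤ c 0 + 3 * l ∧
          c 1 - 3 * l ≤ z 1 ∧ z 1 ≤ c 1 + 3 * l) ∧ ∀ e ∈ R.edges, e ∈ ω)) →
    ((∃ (a b : Site 2) (T : (zdGraph 2).Walk a b), a 0 = c 0 - 3 * l ∧ b 0 = c 0 + 3 * l ∧
        (∀ z ∈ T.support, c 0 - 3 * l ≤ z 0 ∧ z 0 ≤ c 0 + 3 * l ∧
          c 1 + l + 1 ≤ z 1 ∧ z 1 ≤ c 1 + 3 * l) ∧ ∀ e ∈ T.edges, e ∈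
          (BondConfig.relabel (sym2Equiv ((zdShiftIso c).comp ((zdSignedPermIso
            (Equiv.swap (0 : Fin 2) 1) ![1, -1]).comp (zdShiftIso (-c)))).toEquiv))^[k] ω) ∧
      (∃ (a b : Site 2) (B : (zdGraph 2).Walk a b), a 0 = c 0 - 3 * l ∧ b 0 = c 0 + 3 * l ∧
        (∀ z ∈ B.support, c 0 - 3 * l ≤ z 0 ∧ z 0 ≤ c 0 + 3 * l ∧
          c 1 - 3 * l ≤ z 1 ∧ z 1 ≤ c 1 - l - 1) ∧ ∀ e ∈ B.edges, e ∈
          (BondConfig.relabel (sym2Equiv ((zdShiftIso c).comp ((zdSignedPermIso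
            (Equiv.swap (0 : Fin 2) 1) ![1, -1]).comp (zdShiftIso (-c)))).toEquiv))^[k] ω) ∧
      (∃ (a b : Site 2) (L : (zdGraph 2).Walk a b), a 1 = c 1 - 3 * l ∧ b 1 = c 1 + 3 * l ∧
        (∀ z ∈ L.support, c 0 - 3 * l ≤ z 0 ∧ z 0 ≤ c 0 - l - 1 ∧
          c 1 - 3 * l ≤ z 1 ∧ z 1 ≤ c 1 + 3 * l) ∧ ∀ e ∈ L.edges, e ∈
          (BondConfig.relabel (sym2Equiv ((zdShiftIso c).comp ((zdSignedPermIso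
            (Equiv.swap (0 : Fin 2) 1) ![1, -1]).comp (zdShiftIso (-c)))).toEquiv))^[k] ω) ∧
      (∃ (a b : Site 2) (R : (zdGraph 2).Walk a b), a 1 = c 1 - 3 * l ∧ b 1 = c 1 + 3 * l ∧
        (∀ z ∈ R.support, c 0 + l + 1 ≤ z 0 ∧ z 0 ≤ c 0 + 3 * l ∧
          c 1 - 3 * l ≤ z 1 ∧ z 1 ≤ c 1 + 3 * l) ∧ ∀ e ∈ R.edges, e ∈
          (BondConfig.relabel (sym2Equiv ((zdShiftIso c).comp ((zdSignedPermIso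
            (Equiv.swap (0 : Fin 2) 1) ![1, -1]).comp (zdShiftIso (-c)))).toEquiv))^[k] ω)) := by
  induction k with
  | zero => intro ω h; simpa using h
  | succ k ih =>
    intro ω h
    rw [Function.iterate_succ_apply']
    exact fourWalks_relabel_quarterTurn (ih h)

end Summit.CriticalPhenomena.CardyFormulaZ2.Cruxes.RectilinearCardy.ExcursionKernelCovariance

end
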